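import Summits.QuantumFields.GaugeBoot.DiagonalRPTorusNegative
import Literature.MathematicalPhysics.QuantumFieldTheory.WilsonPlaquettePositivity
import Literature.MathematicalPhysics.QuantumFieldTheory.LatticeGaugeTorusAreaLaw
import Literature.MathematicalPhysics.QuantumFieldTheory.UnitaryTraceConcentration
import Literature.MathematicalPhysics.QuantumFieldTheory.LatticeGaugeAsymptoticsFreeEnergyProofs
import HarnessLib

/-!
# Closed-half diagonal RP on a torus forces a non-negative plaquette — hence FAILS at every
`β < 0`, on every torus, in every dimension (gauge-boot, task L3(θ′), 1/2)

HONEST FRAMING (cell `pub-gaugeboot`, page 1 of every file): the venture produces certified bounds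
on lattice expectations at stated coupling, gauge group, dimension and torus size; NOT a mass gap,
NOT a continuum limit, NOT a string tension; NOT Yang–Mills-summit-bearing (barriers
`FixedCouplingUltralocality`, `PerturbativeInvisibility`). This module is a small structural
result about which positivity constraints a TORUS certificate may use (no certificate of the cell
sits at `β < 0`); it discharges nothing else.

## Content

Torus `(ℤ/L)^d`, `L ≥ 2`, directions `i ≠ j`, the diagonal swap `Θ = configDiagSwap i j`
(`y ↦ y ∘ (i j)`), the closed diagonal half `{0 ≤ (y_i - y_j) mod L ≤ L/2}` and the torus
transplant `DiagonalReflectionPositive ρ β i j` of closed-half diagonal reflection positivity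
(`DiagonalRPTorusNegative.lean`; Kazakov–Zheng's third reflection family).

* **`wilsonExpectation_re_trace_plaquette_nonneg_of_diagonalReflectionPositive`** — for EVERY
  compact group `G`, every continuous `ρ : G → M_N(ℂ)`, every `d`, `L ≥ 2`, `β ∈ ℝ`:
  `DiagonalReflectionPositive ρ β i j → 0 ≤ ⟨Re tr ρ(U_{0;ij})⟩_{Λ,β}`; by the symmetries of the
  torus (`wilsonExpectation_plaquetteCost_eq`, tree) the same for EVERY plaquette in EVERY plane
  (`…_nonneg_of_diagonalReflectionPositive'`).
* **`not_diagonalReflectionPositive_of_neg`** — if some central `z` acts in `ρ` by a scalar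
  `ω ≠ 1` (`N ≥ 1`; the centre of `SU(N)`, `-1 ∈ U(N)`), then for every `β < 0`:
  `¬ DiagonalReflectionPositive ρ β i j` — on EVERY torus `(ℤ/L)^d`, `L ≥ 2`, `d ≥ 2`, odd or even.
  Instances `…_specialUnitary` / `…_unitary` (models `G ≅ SU(N)`, `N ≥ 2` / `G ≅ U(N)`, `N ≥ 1`),
  `…_suN` / `…_uN` (the matrix groups themselves).
* `norm_eq_one_of_map_eq_smul_one` — a scalar value `ρ z = ω • 1` of a continuous representation
  of a compact group is unimodular (so the tree's hypothesis `‖ω‖ = 1` is automatic).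

The companion module `DiagonalRPTorusTwoAllBeta.lean` (2/2) draws the `d = 2` consequences: the
classification `DiagonalReflectionPositive ρ β i j ↔ (Odd L ∧ 0 ≤ β) ∨ β = 0` on `(ℤ/L)²`, `L ≥ 3`,
for ALL real `β`, and `⟨Re tr ρ(U_p)⟩ ≥ 0` on odd two-tori at `β ≥ 0` for every `ρ`.

## Mechanism

The plaquette at the origin of the `(i, j)` plane is cut by the mirror `y_i = y_j` into the two
transports `C = U(0,i) U(e_i,j)` and `D = U(0,j) U(e_j,i)` from `0` to `e_i + e_j` (both endpoints
ON the mirror, hence fixed by the swap): `U_{0;ij} = C D⁻¹`, `C` is a closed-half observable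
(levels `0, 1, 0`; `L ≥ 2`) and `C ∘ Θ = D`. With `σ = unitarize ρ` (tree `UnitaryTrick`: same
character, unitary values) the character kernel is a Gram form,
`Re tr ρ(C D⁻¹) = ∑_{a,b} Re (σ(C)_{ab} · conj σ(D)_{ab})` (`CompactGroup.re_trace_mul_inv_eq_sum`),
i.e. `Re tr ρ(U_{0;ij}) = ∑_{a,b} Re ((Θ F_{ab})‾ F_{ab})` with the `N²` bounded measurable
closed-half observables `F_{ab} = σ(C)_{ab}`. Diagonal RP makes every summand's expectation
`≥ 0`. At `β < 0` this contradicts `⟨Re tr ρ(U_p)⟩_{Λ,β} < 0` (tree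
`wilsonExpectation_re_trace_plaquette_neg`: strict monotonicity of the mean action from
`⟨S⟩_0 = N·#P`, which is where the central element enters). No second countability of `G` is
needed (entrywise measurability, `WilsonRP.EntryMeasurable`).

Previously in the tree at `β < 0`: `d ≥ 3`, `L` even — false at every `β` (geometric,
`not_diagonalReflectionPositive`); `d = 2`, `L ≥ 4` even — false at every `β ≠ 0`
(`DiagRPTwo.not_diagonalReflectionPositive_two`); `L = 2` — false at every `β`. NEW here: every
ODD torus in every `d ≥ 2` at every `β < 0` (for `d ≥ 3` odd tori only windows of small `β > 0`
were known: `DiagRPThree.…`, `DiagRPSUN.…`, `…HighDim…`), by one uniform short argument.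

## What is NOT claimed

* The GAUGE-INVARIANT sector (`GaugeInvariantDiagonalRP`, `BackInvariantDiagonalRP`,
  `InnerDiagonalRP`) at `β < 0`: the witnesses `σ(C)_{ab}` are gauge-VARIANT (open transports);
  whether gauge-invariant closed-half diagonal RP survives at `β < 0` on two-tori is left open.
* Representations without a non-trivial central scalar (e.g. with a trivial subrepresentation):
  only the implication "RP ⇒ plaquette ≥ 0" is asserted for them.
* Nothing about `β > 0` beyond the tree; nothing about `ℤ^d` / free boxes (there diagonal RP holds
  for `β ≥ 0` and fails for `β < 0`, `DiagRP.isReflectionPositiveFor_diag_ymSpecification_iff`).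

References: K. Osterwalder, E. Seiler, Ann. Phys. 110 (1978) 440, §2 (the Gram form of the
crossing-plaquette kernel); I. Montvay, G. Münster, *Quantum Fields on a Lattice* (1994) §3.2
(3.113) (internal energy = mean plaquette); V. Kazakov, Z. Zheng, arXiv:2203.11360 §3.1 (the
diagonal family). The statements themselves are elementary and, as far as the cell's searches go
(corpus montvay1994 pp. 70/184, creutz2022, greensite2011; galaxy), not in print.
-/

open MeasureTheory Complex Finset Function
open scoped ComplexOrder

namespace Summit.QuantumFields.GaugeBoot

open Literature.MathematicalPhysics.QuantumFieldTheory
open Literature.RepresentationTheory.CompactGroups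

noncomputable section

/-! ## The cut plaquette at the origin -/

section Geometry

variable {d L : ℕ} {G : Type*} [Group G]

/-- The swap fixes the origin. -/
theorem siteDiagSwap_zero (i j : Fin d) : siteDiagSwap i j (0 : Site d L) = 0 := by
  funext k
  simp [siteDiagSwap]

/-- `Θ` carries the transport `C = U(0,i) U(e_i,j)` (inside the closed half) to
`D = U(0,j) U(e_j,i)` (inside the opposite closed half): `C(ΘU) = D(U)`. -/
theorem halfPlaquette_configDiagSwap (i j : Fin d) (U : GaugeConfig d L G) :
    configDiagSwap i j U (0, i) * configDiagSwap i j U ((0 : Site d L).shift i, j) =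
      U (0, j) * U ((0 : Site d L).shift j, i) := by
  simp only [configDiagSwap, edgeDiagSwap, siteDiagSwap_shift, siteDiagSwap_zero,
    Equiv.swap_apply_left, Equiv.swap_apply_right]

/-- The plaquette holonomy at the origin is `C D⁻¹`. -/
theorem plaquetteHolonomy_zero_eq_mul_inv (i j : Fin d) (U : GaugeConfig d L G) :
    plaquetteHolonomy U 0 i j =
      (U (0, i) * U ((0 : Site d L).shift i, j)) * (U (0, j) * U ((0 : Site d L).shift j, i))⁻¹ := by
  simp only [plaquetteHolonomy, mul_inv_rev, mul_assoc]

/-- Any function of the transport `C = U(0,i) U(e_i,j)` is an observable of the closed diagonal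
half `{0 ≤ (y_i - y_j) mod L ≤ L/2}` (`L ≥ 2`: the three sites `0, e_i, e_i + e_j` have levels
`0, 1, 0`). -/
theorem isDiagonalHalfObservable_comp_halfPlaquette [NeZero L] [Fact (1 < L)] {α : Type*}
    {i j : Fin d} (hij : i ≠ j) (φ : G → α) :
    IsDiagonalHalfObservable i j
      (fun U : GaugeConfig d L G => φ (U (0, i) * U ((0 : Site d L).shift i, j))) := by
  intro U V hUV
  have hL : 1 < L := Fact.out
  have h1 : (1 : ZMod L).val ≤ L / 2 := by rw [ZMod.val_one]; omega
  have hji : j ≠ i := fun h => hij h.symm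
  have hlev1 : (((0 : Site d L).shift i) i - ((0 : Site d L).shift i) j).val ≤ L / 2 := by
    simpa [Site.shift, Pi.single_eq_of_ne hji] using h1
  have hlev2 : ((((0 : Site d L).shift i).shift j) i - (((0 : Site d L).shift i).shift j) j).val
      ≤ L / 2 := by
    simp [Site.shift, Pi.single_eq_of_ne hji, Pi.single_eq_of_ne hij]
  have hA : U (0, i) = V (0, i) := hUV (0, i) (by simp) hlev1
  have hB : U ((0 : Site d L).shift i, j) = V ((0 : Site d L).shift i, j) := hUV _ hlev1 hlev2
  simp only [hA, hB]

end Geometry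

/-! ## Diagonal RP forces a non-negative plaquette -/

section General

variable {d L N : ℕ} [NeZero L] {G : Type*} [Group G] [TopologicalSpace G] [IsTopologicalGroup G]
  [CompactSpace G] [MeasurableSpace G] [BorelSpace G] (ρ : G →* Matrix (Fin N) (Fin N) ℂ)

/-- The real plaquette character is integrable for the Wilson measure (bounded by `N`,
entrywise measurable). -/
private theorem integrable_re_trace_plaquette_wilson (hρ : Continuous ρ) (β : ℝ) (x : Site d L)
    (i j : Fin d) :
    Integrable (fun U : GaugeConfig d L G => (ρ (plaquetteHolonomy U x i j)).trace.re)
      (wilsonMeasure ρ β) := by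
  haveI := isProbabilityMeasure_wilsonMeasure (d := d) (L := L) (G := G) ρ hρ β
  have hE : WilsonRP.EntryMeasurable ρ (fun U : GaugeConfig d L G => plaquetteHolonomy U x i j) := by
    unfold plaquetteHolonomy
    exact (((WilsonRP.entryMeasurable_apply hρ _).mul (WilsonRP.entryMeasurable_apply hρ _)).mul
      (WilsonRP.entryMeasurable_apply_inv hρ _)).mul (WilsonRP.entryMeasurable_apply_inv hρ _)
  refine Integrable.of_bound hE.measurable_trace_re.aestronglyMeasurable (N : ℝ)
    (ae_of_all _ fun U => ?_)
  rw [Real.norm_eq_abs]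
  simpa using CompactGroup.abs_re_trace_le_card ρ hρ (plaquetteHolonomy U x i j)

/-- ★ **Closed-half diagonal RP on the torus forces `⟨Re tr ρ(U_{0;ij})⟩_{Λ,β} ≥ 0`.** For every
compact group `G`, continuous `ρ : G → M_N(ℂ)`, `d`, `L ≥ 2`, `i ≠ j` and `β ∈ ℝ`: if
`DiagonalReflectionPositive ρ β i j` holds then the plaquette at the origin of the `(i, j)` plane
has non-negative mean character. Proof: `Re tr ρ(U_{0;ij}) = ∑_{a,b} Re((ΘF_{ab})‾ F_{ab})` with the
closed-half observables `F_{ab} = σ(U(0,i)U(e_i,j))_{ab}`, `σ` the unitarisation of `ρ`. -/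
theorem wilsonExpectation_re_trace_plaquette_nonneg_of_diagonalReflectionPositive [Fact (1 < L)]
    (hρ : Continuous ρ) {β : ℝ} {i j : Fin d} (hij : i ≠ j)
    (hRP : DiagonalReflectionPositive (d := d) (L := L) ρ β i j) :
    0 ≤ wilsonExpectation ρ β
      (fun U : GaugeConfig d L G => (ρ (plaquetteHolonomy U 0 i j)).trace.re) := by
  haveI := isProbabilityMeasure_wilsonMeasure (d := d) (L := L) (G := G) ρ hρ β
  set σ := CompactGroup.unitarize ρ hρ with hσ
  have hσc : Continuous σ := CompactGroup.continuous_unitarize ρ hρ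
  -- the two half plaquettes
  set C : GaugeConfig d L G → G := fun U => U (0, i) * U ((0 : Site d L).shift i, j) with hC
  set D : GaugeConfig d L G → G := fun U => U (0, j) * U ((0 : Site d L).shift j, i) with hD
  have hCΘ : ∀ U, C (configDiagSwap i j U) = D U := fun U => halfPlaquette_configDiagSwap i j U
  have hCm : WilsonRP.EntryMeasurable σ C :=
    (WilsonRP.entryMeasurable_apply hσc _).mul (WilsonRP.entryMeasurable_apply hσc _)
  have hDm : WilsonRP.EntryMeasurable σ D :=
    (WilsonRP.entryMeasurable_apply hσc _).mul (WilsonRP.entryMeasurable_apply hσc _)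
  -- the real integrands `g_{ab}` and their sum
  set g : Fin N → Fin N → GaugeConfig d L G → ℝ :=
    fun a b U => (σ (C U) a b * (starRingEnd ℂ) (σ (D U) a b)).re with hg
  have hsum : ∀ U : GaugeConfig d L G,
      (ρ (plaquetteHolonomy U 0 i j)).trace.re = ∑ a, ∑ b, g a b U := fun U => by
    rw [plaquetteHolonomy_zero_eq_mul_inv]
    exact CompactGroup.re_trace_mul_inv_eq_sum ρ hρ (C U) (D U)
  have hfm : ∀ a b, Measurable fun U => σ (C U) a b * (starRingEnd ℂ) (σ (D U) a b) :=
    fun a b => (hCm a b).mul (Complex.continuous_conj.measurable.comp (hDm a b))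
  have hfb : ∀ a b U, ‖σ (C U) a b * (starRingEnd ℂ) (σ (D U) a b)‖ ≤ 1 := fun a b U => by
    rw [norm_mul, Complex.norm_conj]
    calc ‖σ (C U) a b‖ * ‖σ (D U) a b‖ ≤ 1 * 1 :=
          mul_le_mul (CompactGroup.norm_unitarize_apply_le_one ρ hρ _ a b)
            (CompactGroup.norm_unitarize_apply_le_one ρ hρ _ a b) (norm_nonneg _) zero_le_one
      _ = 1 := one_mul 1
  have hfi : ∀ a b, Integrable (fun U => σ (C U) a b * (starRingEnd ℂ) (σ (D U) a b))
      (wilsonMeasure ρ β) :=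
    fun a b => Integrable.of_bound (hfm a b).aestronglyMeasurable 1 (ae_of_all _ (hfb a b))
  have hgi : ∀ a b, Integrable (g a b) (wilsonMeasure ρ β) := fun a b => (hfi a b).re
  -- each term is non-negative: diagonal RP applied to `F_{ab} = σ(C)_{ab}`
  have hterm : ∀ a b, 0 ≤ ∫ U, g a b U ∂(wilsonMeasure ρ β) := by
    intro a b
    have h := hRP (fun U => σ (C U) a b) (hCm a b)
      ⟨1, fun U => CompactGroup.norm_unitarize_apply_le_one ρ hρ _ a b⟩
      (isDiagonalHalfObservable_comp_halfPlaquette hij fun x => σ x a b)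
    have hint : (fun U => (starRingEnd ℂ) (σ (C (configDiagSwap i j U)) a b) * σ (C U) a b) =
        fun U => σ (C U) a b * (starRingEnd ℂ) (σ (D U) a b) := by
      funext U
      rw [hCΘ U, mul_comm]
    unfold wilsonExpectation at h
    rw [hint] at h
    have hre := integral_re (hfi a b)
    simp only [RCLike.re_to_complex] at hre
    change 0 ≤ ∫ U, (σ (C U) a b * (starRingEnd ℂ) (σ (D U) a b)).re ∂(wilsonMeasure ρ β)
    rw [hre]
    exact (Complex.nonneg_iff.1 h).1
  -- sum over `a, b`
  calc (0 : ℝ) ≤ ∑ a, ∑ b, ∫ U, g a b U ∂(wilsonMeasure ρ β) :=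
        Finset.sum_nonneg fun a _ => Finset.sum_nonneg fun b _ => hterm a b
    _ = ∫ U, ∑ a, ∑ b, g a b U ∂(wilsonMeasure ρ β) := by
        rw [integral_finsetSum Finset.univ
          (fun a _ => integrable_finsetSum Finset.univ fun b _ => hgi a b)]
        exact Finset.sum_congr rfl fun a _ =>
          (integral_finsetSum Finset.univ fun b _ => hgi a b).symm
    _ = wilsonExpectation ρ β
          (fun U : GaugeConfig d L G => (ρ (plaquetteHolonomy U 0 i j)).trace.re) := by
        unfold wilsonExpectation
        exact integral_congr_ae (ae_of_all _ fun U => (hsum U).symm)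

/-- ★ **… hence every plaquette in every plane has non-negative mean character** (translations and
axis permutations of the torus, tree `wilsonExpectation_plaquetteCost_eq`). -/
theorem wilsonExpectation_re_trace_plaquette_nonneg_of_diagonalReflectionPositive' [Fact (1 < L)]
    (hρ : Continuous ρ) {β : ℝ} {i j : Fin d} (hij : i ≠ j)
    (hRP : DiagonalReflectionPositive (d := d) (L := L) ρ β i j) (x : Site d L) {i' j' : Fin d}
    (hij' : i' ≠ j') :
    0 ≤ wilsonExpectation ρ β
      (fun U : GaugeConfig d L G => (ρ (plaquetteHolonomy U x i' j')).trace.re) := by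
  haveI := isProbabilityMeasure_wilsonMeasure (d := d) (L := L) (G := G) ρ hρ β
  have h0 := wilsonExpectation_re_trace_plaquette_nonneg_of_diagonalReflectionPositive ρ hρ hij hRP
  have hc := wilsonExpectation_plaquetteCost_eq ρ hρ β (x := 0) (x' := x) hij hij'
  have hsub : ∀ (y : Site d L) (k l : Fin d), wilsonExpectation ρ β (fun U : GaugeConfig d L G =>
      (N : ℝ) - (ρ (plaquetteHolonomy U y k l)).trace.re) =
      N - wilsonExpectation ρ β (fun U : GaugeConfig d L G =>
        (ρ (plaquetteHolonomy U y k l)).trace.re) := fun y k l => by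
    simp only [wilsonExpectation]
    rw [integral_sub (integrable_const _) (integrable_re_trace_plaquette_wilson ρ hρ β y k l),
      integral_const, probReal_univ, one_smul]
  rw [hsub, hsub] at hc
  linarith

omit [MeasurableSpace G] [BorelSpace G] in
/-- For a continuous representation of a COMPACT group, a scalar value `ρ z = ω • 1` (`N ≥ 1`)
is unimodular: `‖ω‖ = 1` (the unitarised `σ z = ω • 1` is unitary). -/
theorem norm_eq_one_of_map_eq_smul_one [NeZero N] (hρ : Continuous ρ) {z : G} {ω : ℂ}
    (hω : ρ z = ω • (1 : Matrix (Fin N) (Fin N) ℂ)) : ‖ω‖ = 1 := by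
  have hσz : CompactGroup.unitarize ρ hρ z = ω • (1 : Matrix (Fin N) (Fin N) ℂ) := by
    rw [CompactGroup.unitarize_apply, hω, Matrix.mul_smul, Matrix.mul_one, Matrix.smul_mul,
      Matrix.mul_nonsing_inv _ (CompactGroup.isUnit_det_unitarizer ρ hρ)]
  have hu := CompactGroup.unitarize_mul_star_self ρ hρ z
  rw [hσz, star_smul, star_one, Matrix.smul_mul, Matrix.one_mul, smul_smul] at hu
  have h00 := congrFun (congrFun hu 0) 0
  simp only [Matrix.smul_apply, Matrix.one_apply_eq, smul_eq_mul, mul_one, Complex.star_def,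
    Complex.mul_conj] at h00
  have hsq : ‖ω‖ ^ 2 = 1 := by
    rw [← Complex.normSq_eq_norm_sq]
    exact_mod_cast h00
  nlinarith [norm_nonneg ω]

/-- ★★ **CLOSED-HALF DIAGONAL RP FAILS AT EVERY `β < 0` ON EVERY TORUS, IN EVERY DIMENSION.**
`G` compact, `ρ : G → M_N(ℂ)` continuous (`N ≥ 1`) with a central `z` acting by a scalar `ω ≠ 1`
(the centre of `SU(N)` in the fundamental representation, `-1 ∈ U(N)`, any `ω ≠ 1` in `U(1)`),
torus `(ℤ/L)^d` with `L ≥ 2`, `i ≠ j`, `β < 0`: `¬ DiagonalReflectionPositive ρ β i j` — the RP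
inequality would force `⟨Re tr ρ(U_p)⟩ ≥ 0`, but the mean plaquette character is `< 0` at
`β < 0` (tree `wilsonExpectation_re_trace_plaquette_neg`). Odd `L` included (new in every `d`). -/
theorem not_diagonalReflectionPositive_of_neg [Fact (1 < L)] [NeZero N] (hρ : Continuous ρ)
    {z : G} {ω : ℂ} (hω : ρ z = ω • (1 : Matrix (Fin N) (Fin N) ℂ)) (hne : ω ≠ 1)
    {β : ℝ} (hβ : β < 0) {i j : Fin d} (hij : i ≠ j) :
    ¬ DiagonalReflectionPositive (d := d) (L := L) ρ β i j := fun hRP =>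
  absurd (wilsonExpectation_re_trace_plaquette_neg ρ hρ hω
      (norm_eq_one_of_map_eq_smul_one ρ hρ hω) hne hβ (0 : Site d L) hij)
    (not_lt.2
      (wilsonExpectation_re_trace_plaquette_nonneg_of_diagonalReflectionPositive ρ hρ hij hRP))

/-- ★★ The same for every model `G ≅ SU(N)`, `N ≥ 2` (`IsSpecialUnitaryModel ρ`): closed-half
diagonal RP fails on every torus `(ℤ/L)^d`, `L ≥ 2`, at every `β < 0`. -/
theorem not_diagonalReflectionPositive_of_neg_specialUnitary [Fact (1 < L)]
    (hρ : IsSpecialUnitaryModel ρ) (hN : 2 ≤ N) {β : ℝ} (hβ : β < 0) {i j : Fin d} (hij : i ≠ j) :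
    ¬ DiagonalReflectionPositive (d := d) (L := L) ρ β i j := by
  haveI : NeZero N := ⟨by omega⟩
  obtain ⟨z, ζ, hζ1, hz, -⟩ := IsSpecialUnitaryModel.exists_central ρ hρ hN
  exact not_diagonalReflectionPositive_of_neg ρ hρ.1 hz hζ1 hβ hij

/-- ★★ The same for every model `G ≅ U(N)`, `N ≥ 1` (`IsUnitaryModel ρ`; `N = 1`: compact `U(1)`):
closed-half diagonal RP fails on every torus `(ℤ/L)^d`, `L ≥ 2`, at every `β < 0`. -/
theorem not_diagonalReflectionPositive_of_neg_unitary [Fact (1 < L)] (hρ : IsUnitaryModel ρ)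
    (hN : 1 ≤ N) {β : ℝ} (hβ : β < 0) {i j : Fin d} (hij : i ≠ j) :
    ¬ DiagonalReflectionPositive (d := d) (L := L) ρ β i j := by
  haveI : NeZero N := ⟨by omega⟩
  obtain ⟨z, hz, -⟩ := IsUnitaryModel.exists_central ρ hρ
  have hz' : ρ z = (-1 : ℂ) • (1 : Matrix (Fin N) (Fin N) ℂ) := by rw [hz, neg_one_smul]
  exact not_diagonalReflectionPositive_of_neg ρ hρ.1 hz' (by norm_num) hβ hij

end General

/-! ## The concrete groups `SU(N)` and `U(N)` (every dimension) -/

section Groups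

open Literature.MathematicalPhysics.QuantumLattice

/-- ★★ **`SU(N)` lattice gauge theory (`N ≥ 2`) violates closed-half diagonal RP on every torus
`(ℤ/L)^d`, `L ≥ 2`, at every `β < 0`** (defining representation of
`Matrix.specialUnitaryGroup (Fin N) ℂ`; not vacuous). -/
theorem not_diagonalReflectionPositive_of_neg_suN {d L N : ℕ} [NeZero L] (hL : 2 ≤ L)
    (hN : 2 ≤ N) {β : ℝ} (hβ : β < 0) {i j : Fin d} (hij : i ≠ j) :
    ¬ DiagonalReflectionPositive (d := d) (L := L) (fundamentalRep (Fin N)) β i j := by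
  haveI : Fact (1 < L) := ⟨by omega⟩
  exact not_diagonalReflectionPositive_of_neg_specialUnitary (fundamentalRep (Fin N))
    (TorusAreaLaw.isSpecialUnitaryModel_fundamentalRep N) hN hβ hij

/-- ★★ **`U(N)` lattice gauge theory (`N ≥ 1`; `N = 1`: compact `U(1)`) violates closed-half
diagonal RP on every torus `(ℤ/L)^d`, `L ≥ 2`, at every `β < 0`** (defining representation of
`Matrix.unitaryGroup (Fin N) ℂ`; not vacuous). -/
theorem not_diagonalReflectionPositive_of_neg_uN {d L N : ℕ} [NeZero L] (hL : 2 ≤ L)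
    (hN : 1 ≤ N) {β : ℝ} (hβ : β < 0) {i j : Fin d} (hij : i ≠ j) :
    ¬ DiagonalReflectionPositive (d := d) (L := L) (unitaryFundamentalRep (Fin N) ℂ) β i j := by
  haveI : Fact (1 < L) := ⟨by omega⟩
  exact not_diagonalReflectionPositive_of_neg_unitary (unitaryFundamentalRep (Fin N) ℂ)
    (isUnitaryModel_unitaryFundamentalRep N) hN hβ hij

end Groups

end

end Summit.QuantumFields.GaugeBoot
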